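import Literature.Probability.Percolation.QuadCrossingLowerSets
import Literature.Topology.PlaneTopology.BandCrossing
import Literature.Topology.PlaneTopology.CellSchoenflies
import Literature.Probability.RandomPlanarGeometry.RectangleConformalMap
import Mathlib.Topology.MetricSpace.Thickening
import HarnessLib

/-!
# Proof of Schramm–Smirnov's Theorem 1.4: every quad is a limit of strictly smaller quads

Topic `Literature/Probability/Percolation`; sibling proofs file of `QuadCrossingSpace.lean`,
discharging its named fact `SchrammSmirnov2011_thm_1_4` (O. Schramm, S. Smirnov, *On the
scaling limits of planar percolation*, Ann. Probab. 39 (2011), Thm. 1.4 (1)–(2)) as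
`SchrammSmirnov2011_thm_1_4_holds`.

By `SchrammSmirnov2011_thm_1_4_of_esb` (`QuadCrossingLowerSets.lean`, the abstract §3 of the
source) it remains to prove condition `(3.2)` for quads: **every quad `Q` of an open `D ⊆ ℂ`
lies in the closure of `{Q' : Q' < Q}`** ("(3.2) holds since a quad `Q₀` can be easily
approximated by smaller quads [e.g., by quads `Q^q` with `q = (-ε, ε, 1+ε, 1-ε)` from the proof
of Lemma 5.1]", p. 1781; there `Q^q` is read in an extension `Q̂₀` of `Q₀` to `[-1, 2]²`, whose
existence is "easy to see (e.g., using the Riemann map onto `ℂ̂ ∖ [Q₀]`)").  We follow this: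

* `Quad.exists_homeomorph_extend` — the quad, read on the square `[-1, 1]² ⊆ ℂ` through the
  affine chart `(x, y) ↦ (2x - 1) + (2y - 1)i`, extends to a homeomorphism `H` of `ℂ`
  (`JordanDomain.exists_homeomorph_eqOn_closure`, the Schoenflies theorem for `2`-cells, from
  the tree's Jordan curve and Schoenflies theorems, `CellSchoenflies.lean`, applied to the
  square `rectDomain 1 1`);
* `Quad.dominated_of_near` — if `H⁻¹ ∘ P'` is `η`-close to the chart of the square and
  `H⁻¹ ∘ P` is `η`-close to the chart of the taller-and-narrower rectangle
  `[-(1-s), 1-s] × [-(1+s), 1+s]` (`0 < η`, `4η < s ≤ 1/2`), then `P ≤ P'`: pull a crossing of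
  `P'` back by `H⁻¹` and apply the crossing lemma `exists_subcontinuum_crossing`
  (`BandCrossing.lean`), then push the sub-continuum forward by `H`;
* `Quad.exists_strictlyDominated_dist_lt` — the quads `Q_s = H ∘ A_s ∘ chart`
  (`A_s (x + iy) = (1-s)x + i(1+s)y`, Schramm–Smirnov's `Q^{q}`, `q = (s, -s, 1-s, 1+s)`) lie in
  `D` and tend to `Q` as `s → 0` (uniform continuity of `H`), and `Q_s < Q` with the
  neighbourhoods `U₁ = B(Q_s, r)`, `U₂ = B(Q, r)` (uniform continuity of `H⁻¹`);
* `Quad.mem_closure_setOf_strictlyDominated` — condition `(3.2)`;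
  `SchrammSmirnov2011_thm_1_4_holds` — Theorem 1.4 (1)–(2).

## References

* O. Schramm, S. Smirnov, *On the scaling limits of planar percolation*, Ann. Probab. 39 (2011)
  1768–1814, §1.3 Thm. 1.4, §3 (3.2) and Thm. 3.9, proof of Lemma 5.1. [SchrammSmirnov2011]
-/

noncomputable section

open scoped unitInterval
open Set Filter Metric Function Complex
open _root_.Topology
open Literature.Topology.PlaneTopology Literature.Probability.RandomPlanarGeometry

namespace Literature.Probability.Percolation

namespace QuadCrossing

variable {D : Set ℂ}

namespace Quad

/-! ### The affine chart `[0,1]² → [-1,1]² ⊆ ℂ` -/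

/-- Real and imaginary parts of `x + yi` for real `x`, `y`. [folklore] -/
theorem re_im_ofReal_add_ofReal_mul_I (x y : ℝ) :
    ((x : ℂ) + (y : ℂ) * Complex.I).re = x ∧ ((x : ℂ) + (y : ℂ) * Complex.I).im = y := by
  constructor <;> simp

/-- Two numbers `x + yi`, `x' + y'i` (`x, y, x', y'` real) are equal iff `x = x'` and `y = y'`.
[folklore] -/
theorem ofReal_add_ofReal_mul_I_inj {x y x' y' : ℝ}
    (h : (x : ℂ) + (y : ℂ) * Complex.I = (x' : ℂ) + (y' : ℂ) * Complex.I) : x = x' ∧ y = y' := by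
  have h1 := congrArg Complex.re h
  have h2 := congrArg Complex.im h
  simp only [(re_im_ofReal_add_ofReal_mul_I _ _).1, (re_im_ofReal_add_ofReal_mul_I _ _).2]
    at h1 h2
  exact ⟨h1, h2⟩

/-- **The affine chart of the square**: `e (x, y) = (2x - 1) + (2y - 1)i` maps `[0,1]²` onto
`[-1, 1]² = Icc (-1) 1 ×ℂ Icc (-1) 1`, with continuous one-sided inverse
`c z = (clamp ((Re z + 1)/2), clamp ((Im z + 1)/2))`. [folklore] -/
theorem exists_chart :
    ∃ c : ℂ → I × I, Continuous c ∧
      (∀ p : I × I, c (((2 * (p.1 : ℝ) - 1 : ℝ) : ℂ) + ((2 * (p.2 : ℝ) - 1 : ℝ) : ℂ) * Complex.I) = p) ∧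
      ∀ z ∈ Icc (-1 : ℝ) 1 ×ℂ Icc (-1 : ℝ) 1,
        (((2 * ((c z).1 : ℝ) - 1 : ℝ) : ℂ) + ((2 * ((c z).2 : ℝ) - 1 : ℝ) : ℂ) * Complex.I) = z := by
  refine ⟨fun z => (projIcc 0 1 zero_le_one ((z.re + 1) / 2),
    projIcc 0 1 zero_le_one ((z.im + 1) / 2)), ?_, fun p => ?_, fun z hz => ?_⟩
  · exact (continuous_projIcc.comp ((continuous_re.add continuous_const).div_const _)).prodMk
      (continuous_projIcc.comp ((continuous_im.add continuous_const).div_const _))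
  · obtain ⟨h1, h2⟩ := re_im_ofReal_add_ofReal_mul_I (2 * (p.1 : ℝ) - 1) (2 * (p.2 : ℝ) - 1)
    refine Prod.ext ?_ ?_
    · simp only [h1]
      rw [show (2 * (p.1 : ℝ) - 1 + 1) / 2 = p.1 by ring]
      exact projIcc_val zero_le_one p.1
    · simp only [h2]
      rw [show (2 * (p.2 : ℝ) - 1 + 1) / 2 = p.2 by ring]
      exact projIcc_val zero_le_one p.2
  · rw [mem_reProdIm, mem_Icc, mem_Icc] at hz
    have h1 : (z.re + 1) / 2 ∈ Icc (0 : ℝ) 1 := ⟨by linarith [hz.1.1], by linarith [hz.1.2]⟩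
    have h2 : (z.im + 1) / 2 ∈ Icc (0 : ℝ) 1 := ⟨by linarith [hz.2.1], by linarith [hz.2.2]⟩
    simp only [projIcc_of_mem zero_le_one h1, projIcc_of_mem zero_le_one h2]
    apply Complex.ext
    · rw [(re_im_ofReal_add_ofReal_mul_I _ _).1]; ring
    · rw [(re_im_ofReal_add_ofReal_mul_I _ _).2]; ring

/-- The chart point of `p ∈ [0,1]²` lies in the closed square `[-1, 1]²`. [folklore] -/
theorem chart_mem_rect (p : I × I) :
    (((2 * (p.1 : ℝ) - 1 : ℝ) : ℂ) + ((2 * (p.2 : ℝ) - 1 : ℝ) : ℂ) * Complex.I) ∈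
      Icc (-1 : ℝ) 1 ×ℂ Icc (-1 : ℝ) 1 := by
  rw [mem_reProdIm, mem_Icc, mem_Icc, (re_im_ofReal_add_ofReal_mul_I _ _).1,
    (re_im_ofReal_add_ofReal_mul_I _ _).2]
  have h1 := p.1.2; have h2 := p.2.2
  simp only [mem_Icc] at h1 h2
  exact ⟨⟨by linarith [h1.1], by linarith [h1.2]⟩, ⟨by linarith [h2.1], by linarith [h2.2]⟩⟩

/-- The shrunk chart point `(1-s)(2x-1) + i(1+s)(2y-1)` lies in `[-2, 2]²` for `0 ≤ s ≤ 1`.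
[folklore] -/
theorem shrinkChart_mem_rect {s : ℝ} (hs : 0 ≤ s) (hs' : s ≤ 1) (p : I × I) :
    ((((1 - s) * (2 * (p.1 : ℝ) - 1) : ℝ) : ℂ) + (((1 + s) * (2 * (p.2 : ℝ) - 1) : ℝ) : ℂ) * Complex.I) ∈
      Icc (-2 : ℝ) 2 ×ℂ Icc (-2 : ℝ) 2 := by
  rw [mem_reProdIm, mem_Icc, mem_Icc, (re_im_ofReal_add_ofReal_mul_I _ _).1,
    (re_im_ofReal_add_ofReal_mul_I _ _).2]
  have h1 := p.1.2; have h2 := p.2.2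
  simp only [mem_Icc] at h1 h2
  refine ⟨⟨?_, ?_⟩, ⟨?_, ?_⟩⟩ <;> nlinarith [h1.1, h1.2, h2.1, h2.2]

/-! ### Extension of a quad to a homeomorphism of the plane -/

/-- **A quad extends to a homeomorphism of the plane** (read through the affine chart of the
square): there is `H : ℂ ≃ₜ ℂ` with `H ((2x-1) + (2y-1)i) = Q (x, y)`.  This is Schramm–Smirnov's
extension `Q̂₀` of `Q₀` ("easy to see, e.g., using the Riemann map", proof of Lemma 5.1), here
from the Schoenflies theorem for `2`-cells `exists_homeomorph_eqOn_closure_symRect`.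
[cite: SchrammSmirnov2011, proof of Lemma 5.1] -/
theorem exists_homeomorph_extend (Q : Quad D) :
    ∃ H : ℂ ≃ₜ ℂ, ∀ p : I × I,
      H (((2 * (p.1 : ℝ) - 1 : ℝ) : ℂ) + ((2 * (p.2 : ℝ) - 1 : ℝ) : ℂ) * Complex.I) = Q p := by
  obtain ⟨c, hcc, hce, hec⟩ := exists_chart
  set f : ℂ → ℂ := fun z => Q (c z) with hf
  have hfc : Continuous f := Q.continuous_toFun.comp hcc
  have hcl : closure (rectDomain 1 1 one_pos one_pos).carrier = Icc (-1 : ℝ) 1 ×ℂ Icc (-1 : ℝ) 1 :=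
    closure_symRect one_pos one_pos
  have hfi : InjOn f (closure (rectDomain 1 1 one_pos one_pos).carrier) := by
    rw [hcl]
    intro z hz z' hz' h
    have h' : c z = c z' := Q.injective_toFun h
    rw [← hec z hz, ← hec z' hz', h']
  obtain ⟨H, hH, -⟩ :=
    (rectDomain 1 1 one_pos one_pos).exists_homeomorph_eqOn_closure hfc.continuousOn hfi
  rw [hcl] at hH
  refine ⟨H, fun p => ?_⟩
  rw [hH (chart_mem_rect p), hf]
  simp only [hce p]

/-! ### Domination from closeness in the straightened picture -/

/-- **`P ≤ P'` from the crossing lemma.** Let `H : ℂ ≃ₜ ℂ`, `s ≤ 1/2`, `0 < η`, `4η < s`.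
If `H⁻¹ ∘ P'` is uniformly `η`-close to the chart `(x,y) ↦ (2x-1) + (2y-1)i` of the square and
`H⁻¹ ∘ P` is uniformly `η`-close to the chart `(x,y) ↦ (1-s)(2x-1) + (1+s)(2y-1)i` of the taller
and narrower rectangle, then every crossing of `P'` contains a crossing of `P`: pull the
crossing back by `H⁻¹`, apply `exists_subcontinuum_crossing` to the continuous injection
`w ↦ H⁻¹(P(chart⁻¹(A_s⁻¹ w)))` of the rectangle, and push the sub-continuum forward by `H`.
[cite: SchrammSmirnov2011, §3 (3.2) and proof of Lemma 5.1] -/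
theorem dominated_of_near (H : ℂ ≃ₜ ℂ) {s η : ℝ} (hs' : s ≤ 1 / 2) (hη : 0 < η)
    (hηs : 4 * η < s) {P P' : Quad D}
    (hP' : ∀ p : I × I,
      ‖H.symm (P' p) - (((2 * (p.1 : ℝ) - 1 : ℝ) : ℂ) + ((2 * (p.2 : ℝ) - 1 : ℝ) : ℂ) * Complex.I)‖ ≤ η)
    (hP : ∀ p : I × I, ‖H.symm (P p) -
      ((((1 - s) * (2 * (p.1 : ℝ) - 1) : ℝ) : ℂ) + (((1 + s) * (2 * (p.2 : ℝ) - 1) : ℝ) : ℂ) * Complex.I)‖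
        ≤ η) :
    Dominated P P' := by
  have hs : 0 < s := by linarith
  have ha : (0 : ℝ) < 1 - s := by linarith
  have hb : (0 : ℝ) < 1 + s := by linarith
  obtain ⟨c, hcc, hce, hec⟩ := exists_chart
  set R := Icc (-(1 - s)) (1 - s) ×ℂ Icc (-(1 + s)) (1 + s) with hR
  -- the inverse `B` of `A_s (x + iy) = (1-s)x + i(1+s)y`
  set B : ℂ → ℂ := fun w => ((w.re / (1 - s) : ℝ) : ℂ) + ((w.im / (1 + s) : ℝ) : ℂ) * Complex.I with hB
  have hBc : Continuous B := by fun_prop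
  have hBre : ∀ w, (B w).re = w.re / (1 - s) ∧ (B w).im = w.im / (1 + s) := fun w =>
    re_im_ofReal_add_ofReal_mul_I _ _
  have hBS : ∀ w ∈ R, B w ∈ Icc (-1 : ℝ) 1 ×ℂ Icc (-1 : ℝ) 1 := fun w hw => by
    rw [mem_reProdIm, mem_Icc, mem_Icc, (hBre w).1, (hBre w).2]
    rw [hR, mem_reProdIm, mem_Icc, mem_Icc] at hw
    refine ⟨⟨?_, ?_⟩, ⟨?_, ?_⟩⟩
    · rw [le_div_iff₀ ha]; linarith [hw.1.1]
    · rw [div_le_iff₀ ha]; linarith [hw.1.2]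
    · rw [le_div_iff₀ hb]; linarith [hw.2.1]
    · rw [div_le_iff₀ hb]; linarith [hw.2.2]
  -- the chart coordinates of `B w`
  have hcB : ∀ w ∈ R, (2 * ((c (B w)).1 : ℝ) - 1) = w.re / (1 - s) ∧
      (2 * ((c (B w)).2 : ℝ) - 1) = w.im / (1 + s) := fun w hw => by
    exact ofReal_add_ofReal_mul_I_inj (hec (B w) (hBS w hw))
  have hAcB : ∀ w ∈ R, ((((1 - s) * (2 * ((c (B w)).1 : ℝ) - 1) : ℝ) : ℂ) +
      (((1 + s) * (2 * ((c (B w)).2 : ℝ) - 1) : ℝ) : ℂ) * Complex.I) = w := fun w hw => by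
    rw [(hcB w hw).1, (hcB w hw).2, mul_div_cancel₀ _ ha.ne', mul_div_cancel₀ _ hb.ne']
    exact Complex.ext (re_im_ofReal_add_ofReal_mul_I _ _).1 (re_im_ofReal_add_ofReal_mul_I _ _).2
  -- the straightened quad `g = H⁻¹ ∘ P ∘ chart⁻¹ ∘ B` on `R`
  set g : ℂ → ℂ := fun w => H.symm (P (c (B w))) with hg
  have hgc : Continuous g := H.symm.continuous.comp (P.continuous_toFun.comp (hcc.comp hBc))
  have hgη : ∀ w ∈ R, ‖g w - w‖ ≤ η := fun w hw => by
    have := hP (c (B w))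
    rwa [hAcB w hw] at this
  have hgi : InjOn g R := by
    intro w hw w' hw' h
    have h1 : c (B w) = c (B w') := P.injective_toFun (H.symm.injective h)
    have h2 : B w = B w' := by rw [← hec (B w) (hBS w hw), ← hec (B w') (hBS w' hw'), h1]
    have h3 := ofReal_add_ofReal_mul_I_inj h2
    rw [div_left_inj' ha.ne', div_left_inj' hb.ne'] at h3
    exact Complex.ext h3.1 h3.2
  -- a crossing of `P'`
  intro K hK
  obtain ⟨hKc, hKconn, hKsub, ⟨w₀, hw₀K, hw₀⟩, ⟨w₂, hw₂K, hw₂⟩⟩ := hK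
  have hw₀' : w₀ ∈ P' '' {z : I × I | z.1 = 0} := hw₀
  have hw₂' : w₂ ∈ P' '' {z : I × I | z.1 = 1} := hw₂
  obtain ⟨p₀, hp₀, rfl⟩ := hw₀'
  obtain ⟨p₂, hp₂, rfl⟩ := hw₂'
  have hp₀' : ((p₀.1 : I) : ℝ) = 0 := by
    have := congrArg Subtype.val (show p₀.1 = 0 from hp₀); simpa using this
  have hp₂' : ((p₂.1 : I) : ℝ) = 1 := by
    have := congrArg Subtype.val (show p₂.1 = 1 from hp₂); simpa using this
  have hKsub' : K ⊆ range P' := hKsub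
  -- its pull-back `K̃ = H⁻¹(K)`
  have hKt_c : IsCompact (H.symm '' K) := hKc.image H.symm.continuous
  have hKt_conn : IsConnected (H.symm '' K) := hKconn.image _ H.symm.continuous.continuousOn
  have hcoord : ∀ p : I × I, |(H.symm (P' p)).re - (2 * (p.1 : ℝ) - 1)| ≤ η ∧
      |(H.symm (P' p)).im - (2 * (p.2 : ℝ) - 1)| ≤ η := fun p => by
    have h := hP' p
    constructor
    · have := (abs_re_le_norm _).trans h
      rwa [sub_re, (re_im_ofReal_add_ofReal_mul_I _ _).1] at this
    · have := (abs_im_le_norm _).trans h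
      rwa [sub_im, (re_im_ofReal_add_ofReal_mul_I _ _).2] at this
  have hKim : ∀ w ∈ H.symm '' K, |w.im| ≤ 1 + η := by
    rintro _ ⟨w, hwK, rfl⟩
    obtain ⟨p, rfl⟩ := hKsub' hwK
    have h := (hcoord p).2
    have h2 := p.2.2
    simp only [mem_Icc] at h2
    rw [abs_le] at h ⊢
    constructor <;> linarith [h.1, h.2, h2.1, h2.2]
  have hK₀ : ∃ w ∈ H.symm '' K, w.re ≤ -1 + η := by
    refine ⟨H.symm (P' p₀), mem_image_of_mem _ hw₀K, ?_⟩
    have h := (hcoord p₀).1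
    rw [hp₀', abs_le] at h
    linarith [h.2]
  have hK₂ : ∃ w ∈ H.symm '' K, 1 - η ≤ w.re := by
    refine ⟨H.symm (P' p₂), mem_image_of_mem _ hw₂K, ?_⟩
    have h := (hcoord p₂).1
    rw [hp₂', abs_le] at h
    linarith [h.1]
  obtain ⟨Kt', hKt'sub, hKt'c, hKt'conn, hKt'R, ⟨x₀, hx₀K, u₀, ⟨hu₀R, hu₀re⟩, rfl⟩,
    ⟨x₂, hx₂K, u₂, ⟨hu₂R, hu₂re⟩, rfl⟩⟩ :=
    exists_subcontinuum_crossing hs' hη hηs hgc.continuousOn hgi hgη hKt_c hKt_conn hKim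
      hK₀ hK₂
  -- push forward by `H`
  refine ⟨H '' Kt', ?_, hKt'c.image H.continuous, hKt'conn.image _ H.continuous.continuousOn,
    ?_, ?_, ?_⟩
  · calc H '' Kt' ⊆ H '' (H.symm '' K) := image_mono hKt'sub
      _ = K := H.toEquiv.image_symm_image K
  · rintro _ ⟨x, hx, rfl⟩
    obtain ⟨w, -, rfl⟩ := hKt'R hx
    show H (g w) ∈ range P
    exact ⟨c (B w), by simp [hg]⟩
  · refine ⟨H (g u₀), mem_image_of_mem H hx₀K, ?_⟩
    show H (g u₀) ∈ P '' {z : I × I | z.1 = 0}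
    refine ⟨c (B u₀), ?_, by simp [hg]⟩
    show (c (B u₀)).1 = 0
    have h := (hcB u₀ hu₀R).1
    rw [hu₀re, neg_div, div_self ha.ne'] at h
    have h' : ((c (B u₀)).1 : ℝ) = 0 := by linarith
    exact Subtype.ext (by simpa using h')
  · refine ⟨H (g u₂), mem_image_of_mem H hx₂K, ?_⟩
    show H (g u₂) ∈ P '' {z : I × I | z.1 = 1}
    refine ⟨c (B u₂), ?_, by simp [hg]⟩
    show (c (B u₂)).1 = 1
    have h := (hcB u₂ hu₂R).1
    rw [hu₂re, div_self ha.ne'] at h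
    have h' : ((c (B u₂)).1 : ℝ) = 1 := by linarith
    exact Subtype.ext (by simpa using h')

/-! ### Strictly smaller quads near `Q` -/

/-- **Smaller quads approximating `Q`** (Schramm–Smirnov's `Q^{q}`, `q = (s, -s, 1-s, 1+s)`,
proof of Lemma 5.1, used for `(3.2)` on p. 1781): for `D` open, `Q ∈ 𝒬_D` and `ε > 0` there is
`Q' ∈ 𝒬_D` with `d(Q', Q) < ε` and `Q' < Q`.  With `H` the extension of `Q`
(`exists_homeomorph_extend`), `Q' = H ∘ A_s ∘ chart` for small `s`: it lies in `D` and near `Q`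
by uniform continuity of `H`, and `P ≤ P'` for all `P ∈ B(Q', r)`, `P' ∈ B(Q, r)` by
`dominated_of_near`, `r` from uniform continuity of `H⁻¹` near `H([-2, 2]²)`.
[cite: SchrammSmirnov2011, §3 (3.2) and proof of Lemma 5.1] -/
theorem exists_strictlyDominated_dist_lt (hD : IsOpen D) (Q : Quad D) {ε : ℝ} (hε : 0 < ε) :
    ∃ Q' : Quad D, dist Q' Q < ε ∧ StrictlyDominated Q' Q := by
  obtain ⟨H, hH⟩ := exists_homeomorph_extend Q
  -- room in `D` around `[Q]`
  obtain ⟨δD, hδD, hthick⟩ :=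
    Q.isCompact_carrier.exists_cthickening_subset_open hD Q.carrier_subset
  -- uniform continuity of `H` on `C = [-2, 2]²`
  set C := Icc (-2 : ℝ) 2 ×ℂ Icc (-2 : ℝ) 2 with hC
  have hCc : IsCompact C := isCompact_rect 2 2
  have hεD : 0 < min (ε / 2) δD := lt_min (by linarith) hδD
  obtain ⟨δ, hδ, hHδ⟩ := Metric.uniformContinuousOn_iff.1
    (hCc.uniformContinuousOn_of_continuous H.continuous.continuousOn) _ hεD
  -- the parameter `s`
  set s : ℝ := min (1 / 2) (δ / 4) with hs_def
  have hs : 0 < s := lt_min (by norm_num) (by linarith)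
  have hs' : s ≤ 1 / 2 := min_le_left _ _
  have hsδ : 2 * s < δ := by
    have := min_le_right (1 / 2 : ℝ) (δ / 4)
    rw [← hs_def] at this
    linarith
  have hs1 : s ≤ 1 := by linarith
  -- chart points
  have hchartC : ∀ p : I × I,
      (((2 * (p.1 : ℝ) - 1 : ℝ) : ℂ) + ((2 * (p.2 : ℝ) - 1 : ℝ) : ℂ) * Complex.I) ∈ C := fun p => by
    have h := chart_mem_rect p
    rw [mem_reProdIm, mem_Icc, mem_Icc] at h
    rw [hC, mem_reProdIm, mem_Icc, mem_Icc]
    exact ⟨⟨by linarith [h.1.1], by linarith [h.1.2]⟩, ⟨by linarith [h.2.1], by linarith [h.2.2]⟩⟩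
  have hshrinkC : ∀ p : I × I, ((((1 - s) * (2 * (p.1 : ℝ) - 1) : ℝ) : ℂ) +
      (((1 + s) * (2 * (p.2 : ℝ) - 1) : ℝ) : ℂ) * Complex.I) ∈ C := fun p =>
    shrinkChart_mem_rect hs.le hs1 p
  -- `A_s` moves chart points by less than `δ`
  have hmove : ∀ p : I × I, dist ((((1 - s) * (2 * (p.1 : ℝ) - 1) : ℝ) : ℂ) +
      (((1 + s) * (2 * (p.2 : ℝ) - 1) : ℝ) : ℂ) * Complex.I)
      (((2 * (p.1 : ℝ) - 1 : ℝ) : ℂ) + ((2 * (p.2 : ℝ) - 1 : ℝ) : ℂ) * Complex.I) < δ := fun p => by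
    have h1 := p.1.2; have h2 := p.2.2
    simp only [mem_Icc] at h1 h2
    rw [dist_eq_norm]
    have : ((((1 - s) * (2 * (p.1 : ℝ) - 1) : ℝ) : ℂ) +
        (((1 + s) * (2 * (p.2 : ℝ) - 1) : ℝ) : ℂ) * Complex.I) -
        (((2 * (p.1 : ℝ) - 1 : ℝ) : ℂ) + ((2 * (p.2 : ℝ) - 1 : ℝ) : ℂ) * Complex.I) =
        ((-(s * (2 * (p.1 : ℝ) - 1)) : ℝ) : ℂ) + ((s * (2 * (p.2 : ℝ) - 1) : ℝ) : ℂ) * Complex.I := by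
      push_cast; ring
    rw [this]
    calc ‖((-(s * (2 * (p.1 : ℝ) - 1)) : ℝ) : ℂ) + ((s * (2 * (p.2 : ℝ) - 1) : ℝ) : ℂ) * Complex.I‖
        ≤ ‖((-(s * (2 * (p.1 : ℝ) - 1)) : ℝ) : ℂ)‖ + ‖((s * (2 * (p.2 : ℝ) - 1) : ℝ) : ℂ) * Complex.I‖ :=
          norm_add_le _ _
      _ = |s * (2 * (p.1 : ℝ) - 1)| + |s * (2 * (p.2 : ℝ) - 1)| := by
          rw [norm_mul, norm_I, mul_one, norm_real, norm_real, Real.norm_eq_abs,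
            Real.norm_eq_abs, abs_neg]
      _ ≤ s * 1 + s * 1 := by
          rw [abs_mul, abs_mul, abs_of_pos hs]
          exact add_le_add (mul_le_mul_of_nonneg_left (abs_le.2 ⟨by linarith, by linarith⟩) hs.le)
            (mul_le_mul_of_nonneg_left (abs_le.2 ⟨by linarith, by linarith⟩) hs.le)
      _ < δ := by linarith
  have hclose : ∀ p : I × I, dist (H ((((1 - s) * (2 * (p.1 : ℝ) - 1) : ℝ) : ℂ) +
      (((1 + s) * (2 * (p.2 : ℝ) - 1) : ℝ) : ℂ) * Complex.I)) (Q p) < min (ε / 2) δD := fun p => by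
    rw [← hH p]
    exact hHδ _ (hshrinkC p) _ (hchartC p) (hmove p)
  -- the smaller quad `Q' = H ∘ A_s ∘ chart`
  let Q' : Quad D :=
    { toFun := fun p => H ((((1 - s) * (2 * (p.1 : ℝ) - 1) : ℝ) : ℂ) +
        (((1 + s) * (2 * (p.2 : ℝ) - 1) : ℝ) : ℂ) * Complex.I)
      continuous_toFun := by fun_prop
      injective_toFun := by
        intro p q hpq
        have h := ofReal_add_ofReal_mul_I_inj (H.injective hpq)
        have ha : (1 - s : ℝ) ≠ 0 := by linarith
        have hb : (1 + s : ℝ) ≠ 0 := by linarith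
        have h1 : (p.1 : ℝ) = q.1 := by
          have := mul_left_cancel₀ ha h.1
          linarith
        have h2 : (p.2 : ℝ) = q.2 := by
          have := mul_left_cancel₀ hb h.2
          linarith
        exact Prod.ext (Subtype.ext h1) (Subtype.ext h2)
      range_subset := by
        rintro _ ⟨p, rfl⟩
        refine hthick (mem_cthickening_of_dist_le _ (Q p) _ _ ⟨p, rfl⟩ ?_)
        exact ((hclose p).trans_le (min_le_right _ _)).le }
  have hQ'apply : ∀ p : I × I, Q' p = H ((((1 - s) * (2 * (p.1 : ℝ) - 1) : ℝ) : ℂ) +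
      (((1 + s) * (2 * (p.2 : ℝ) - 1) : ℝ) : ℂ) * Complex.I) := fun p => rfl
  refine ⟨Q', ?_, ?_⟩
  · -- `d(Q', Q) < ε`
    rw [dist_eq]
    have : dist Q'.toContinuousMap Q.toContinuousMap < ε / 2 + ε / 4 := by
      refine (ContinuousMap.dist_lt_iff (by linarith)).2 fun p => ?_
      simp only [toContinuousMap_apply, hQ'apply]
      exact ((hclose p).trans_le (min_le_left _ _)).trans (by linarith)
    linarith
  · -- `Q' < Q`: uniform continuity of `H⁻¹` on a compact neighbourhood of `H(C)`
    set N := cthickening 1 (H '' C) with hN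
    have hNc : IsCompact N := (hCc.image H.continuous).cthickening
    set η : ℝ := s / 8 with hη_def
    have hη : 0 < η := by positivity
    have hηs : 4 * η < s := by rw [hη_def]; linarith
    obtain ⟨δ', hδ', hHδ'⟩ := Metric.uniformContinuousOn_iff.1
      (hNc.uniformContinuousOn_of_continuous H.symm.continuous.continuousOn) η hη
    set r : ℝ := min 1 δ' with hr_def
    have hr : 0 < r := lt_min one_pos hδ'
    have hr1 : r ≤ 1 := min_le_left _ _
    have hrδ : r ≤ δ' := min_le_right _ _
    -- points within `r` of `H(C)` are in `N`, and `H⁻¹` moves them by `< η`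
    have key : ∀ x z : ℂ, z ∈ C → dist x (H z) < r → ‖H.symm x - z‖ ≤ η := by
      intro x z hz hxz
      have hHz : H z ∈ N := self_subset_cthickening _ (mem_image_of_mem H hz)
      have hx : x ∈ N := mem_cthickening_of_dist_le x (H z) 1 _ (mem_image_of_mem H hz)
        (hxz.le.trans hr1)
      have := hHδ' x hx (H z) hHz (hxz.trans_le hrδ)
      rw [H.symm_apply_apply, dist_eq_norm] at this
      exact this.le
    refine strictlyDominated_iff.2 ⟨ball Q' r, ball Q r, isOpen_ball, isOpen_ball,
      mem_ball_self hr, mem_ball_self hr, fun P hP P' hP' => ?_⟩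
    refine dominated_of_near H hs' hη hηs (fun p => ?_) (fun p => ?_)
    · refine key _ _ (hchartC p) ?_
      rw [hH p]
      exact (dist_apply_le P' Q p).trans_lt (mem_ball.1 hP')
    · refine key _ _ (hshrinkC p) ?_
      rw [← hQ'apply p]
      exact (dist_apply_le P Q' p).trans_lt (mem_ball.1 hP)

/-- **Condition (3.2) for quads**: every quad of an open `D ⊆ ℂ` lies in the closure of the
set of strictly smaller quads ("a quad `Q₀` can be easily approximated by smaller quads",
Schramm–Smirnov (2011), p. 1781). [cite: SchrammSmirnov2011, §3 (3.2)] -/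
theorem mem_closure_setOf_strictlyDominated (hD : IsOpen D) (Q : Quad D) :
    Q ∈ closure {Q' | StrictlyDominated Q' Q} := by
  refine Metric.mem_closure_iff.2 fun ε hε => ?_
  obtain ⟨Q', hd, hlt⟩ := exists_strictlyDominated_dist_lt hD Q hε
  exact ⟨Q', hlt, by rwa [dist_comm]⟩

end Quad

/-- **Schramm–Smirnov, Theorem 1.4 (1)–(2)**: for `D ⊆ ℂ` open (and nonempty), the space
`(ℋ_D, 𝒯_D)` of closed lower sets of quads is a compact metrizable Hausdorff space, a dense set
of quads determines the configuration, and the `V^Q`, `Q` in a dense set, generate the Borel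
`σ`-field.  Proof: the abstract Theorem 3.9 (`SchrammSmirnov2011_thm_1_4_of_esb`) applied to
`𝒬_D` with `<`, condition (3.2) being `Quad.mem_closure_setOf_strictlyDominated`.  This
discharges the named fact `SchrammSmirnov2011_thm_1_4` of `QuadCrossingSpace.lean`.
[cite: SchrammSmirnov2011, Thm. 1.4 (1)–(2)] -/
theorem SchrammSmirnov2011_thm_1_4_holds : SchrammSmirnov2011_thm_1_4 :=
  SchrammSmirnov2011_thm_1_4_of_esb fun _ hD Q => Quad.mem_closure_setOf_strictlyDominated hD Q

end QuadCrossing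

end Literature.Probability.Percolation
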